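import Mathlib.NumberTheory.AbelSummation
import Mathlib.MeasureTheory.Integral.IntervalIntegral.IntegrationByParts
import Mathlib.Analysis.SpecialFunctions.Integrals.Basic
import HarnessLib

/-!
# From a log-Riesz mean to `∑_{n ≤ V} w(n) log((log x − log n)/(log x − log V))`

Topic `Literature/NumberTheory/LFunctions` (companion of `PrimeSumSmoothWeight.lean`; consumed by the
friable Möbius–root sum asymptotics `Literature/NumberTheory/Sieve/FriableMoebiusRootSum*.lean`).
Everything here is PROVED; no definitions, no named facts. For an arbitrary sequence `w : ℕ → ℝ`
write `M(t) = ∑_{1 ≤ n ≤ t} w(n)` and `R(t) = ∑_{1 ≤ n ≤ t} w(n) log(t/n)` (its log-Riesz mean,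
`R(t) = ∫_1^t M(s) ds/s`). For `1 ≤ V < x`, `L = log x`:

* `sum_mul_log_sub_eq_integral` — Abel summation:
  `∑_{n ≤ V} w(n) (log(L − log n) − log(L − log V)) = ∫_1^V M(t) dt/(t (L − log t))`;
* `integral_partialSum_div_eq` — integration by parts through the log-Riesz mean (right
  derivatives, `intervalIntegral.integral_eq_sub_of_hasDeriv_right_of_le`):
  `∫_1^V M(t) dt/(t (L − log t)) = R(V)/(L − log V) − ∫_1^V R(t) dt/(t (L − log t)²)`;
* `abs_integral_logRiesz_div_sub_le` — if `|R(t) − C| ≤ E(t)` on `[1, V]` with `∫_1^V E(t)dt/t ≤ I`, then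
  `|∫_1^V R(t) dt/(t (L − log t)²) − C (1/(L − log V) − 1/L)| ≤ I/(L − log V)²`;
* `abs_sum_mul_log_sub_sub_main_le` — the three combined:
  `|∑_{n ≤ V} w(n)(log(L − log n) − log(L − log V)) − C/L − (R(V) − C)/(L − log V)| ≤ I/(L − log V)²`.

With `V = x/y` (`L − log V = log y`) this is the main term `C/log x + (R(x/y) − C)/log y` of the
friable Möbius–root sum in the range `y ≤ x ≤ y²`.

## References

* H. L. Montgomery, R. C. Vaughan, *Multiplicative Number Theory I*, CUP 2007, §2.1 (Abel
  summation), §8.4 (Landau's method). [MontgomeryVaughan2007]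
-/

open Finset Real MeasureTheory Set intervalIntegral

noncomputable section

namespace Literature.NumberTheory.LFunctions

namespace LogRieszAbel

variable (w : ℕ → ℝ)

/-! ### The log-Riesz mean as a continuous function with right derivative `M(t)/t` -/

/-- On `[1, ∞)` the log-Riesz mean is the finite sum `∑_{n ≤ W} w(n) (log t − log n)⁺` for any
`W ≥ t`. [folklore] -/
theorem logRiesz_eq_sum_posPart {t : ℝ} (ht : 1 ≤ t) {W : ℕ} (hW : ⌊t⌋₊ ≤ W) :
    ∑ n ∈ Icc 1 ⌊t⌋₊, w n * Real.log (t / n) =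
      ∑ n ∈ Icc 1 W, w n * max (Real.log t - Real.log n) 0 := by
  have ht0 : 0 < t := by linarith
  have hsplit : ∀ m : ℕ, Finset.Icc 1 m = Finset.Ioc 0 m := fun m => by ext n; simp; omega
  rw [hsplit, hsplit, ← sum_Ioc_consecutive _ (Nat.zero_le _) hW]
  have htail : ∑ n ∈ Ioc ⌊t⌋₊ W, w n * max (Real.log t - Real.log n) 0 = 0 := by
    refine sum_eq_zero fun n hn => ?_
    have hn' : ⌊t⌋₊ < n := (mem_Ioc.mp hn).1
    have htn : t < n := (Nat.floor_lt ht0.le).mp hn'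
    rw [max_eq_right (by linarith [Real.log_le_log ht0 htn.le]), mul_zero]
  rw [htail, add_zero]
  refine sum_congr rfl fun n hn => ?_
  have hn1 : 1 ≤ n := by have := (mem_Ioc.mp hn).1; omega
  have hn0 : (0 : ℝ) < n := by exact_mod_cast hn1
  have hnt : (n : ℝ) ≤ t := le_trans (by exact_mod_cast (mem_Ioc.mp hn).2) (Nat.floor_le ht0.le)
  have hlog : Real.log n ≤ Real.log t := Real.log_le_log hn0 hnt
  rw [max_eq_left (by linarith), Real.log_div ht0.ne' hn0.ne']

/-- The log-Riesz mean is continuous on `[1, V]`. [folklore] -/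
theorem continuousOn_logRiesz (V : ℝ) :
    ContinuousOn (fun t : ℝ => ∑ n ∈ Icc 1 ⌊t⌋₊, w n * Real.log (t / n)) (Icc 1 V) := by
  have hcont : ContinuousOn
      (fun t : ℝ => ∑ n ∈ Icc 1 ⌊V⌋₊, w n * max (Real.log t - Real.log n) 0) (Icc 1 V) := by
    refine continuousOn_finsetSum _ fun n _ => ?_
    have hlog : ContinuousOn (fun t : ℝ => Real.log t - Real.log n) (Icc 1 V) :=
      (Real.continuousOn_log.mono fun t ht =>
        ne_of_gt (show (0 : ℝ) < t from lt_of_lt_of_le one_pos ht.1)).sub continuousOn_const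
    exact continuousOn_const.mul (hlog.sup continuousOn_const)
  refine hcont.congr fun t ht => ?_
  exact logRiesz_eq_sum_posPart w ht.1 (Nat.floor_le_floor ht.2)

/-- The log-Riesz mean has right derivative `M(t)/t` at every `t ≥ 1`. [folklore] -/
theorem hasDerivWithinAt_logRiesz {t : ℝ} (ht : 1 ≤ t) :
    HasDerivWithinAt (fun s : ℝ => ∑ n ∈ Icc 1 ⌊s⌋₊, w n * Real.log (s / n))
      ((∑ n ∈ Icc 1 ⌊t⌋₊, w n) / t) (Ioi t) t := by
  have ht0 : 0 < t := by linarith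
  -- the frozen sum `g(s) = ∑_{n ≤ ⌊t⌋} w(n) log(s/n)` is differentiable at `t`
  have hg : HasDerivAt (fun s : ℝ => ∑ n ∈ Icc 1 ⌊t⌋₊, w n * Real.log (s / n))
      (∑ n ∈ Icc 1 ⌊t⌋₊, w n * t⁻¹) t := by
    refine HasDerivAt.fun_sum fun n hn => ?_
    have hn0 : (0 : ℝ) < n := by exact_mod_cast (mem_Icc.mp hn).1
    have h1 : HasDerivAt (fun s : ℝ => s / n) (1 / n) t := (hasDerivAt_id t).div_const _
    have h2 : HasDerivAt (fun s : ℝ => Real.log (s / n)) ((1 / n) / (t / n)) t :=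
      h1.log (div_pos ht0 hn0).ne'
    have h3 : (1 / (n : ℝ)) / (t / n) = t⁻¹ := by field_simp
    rw [h3] at h2
    exact h2.const_mul (w n)
  have hsum : ∑ n ∈ Icc 1 ⌊t⌋₊, w n * t⁻¹ = (∑ n ∈ Icc 1 ⌊t⌋₊, w n) / t := by
    rw [← sum_mul, div_eq_mul_inv]
  rw [hsum] at hg
  -- on `(t, ⌊t⌋ + 1)` the floor is frozen
  refine hg.hasDerivWithinAt.congr_of_eventuallyEq ?_ rfl
  have hmem : Ioo t ((⌊t⌋₊ : ℝ) + 1) ∈ nhdsWithin t (Ioi t) := Ioo_mem_nhdsGT (Nat.lt_floor_add_one t)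
  refine Filter.eventuallyEq_of_mem hmem fun s hs => ?_
  have hs0 : 0 ≤ s := ht0.le.trans hs.1.le
  have hfl : ⌊s⌋₊ = ⌊t⌋₊ := by
    rw [Nat.floor_eq_iff hs0]
    exact ⟨(Nat.floor_le ht0.le).trans hs.1.le, hs.2⟩
  simp only [hfl]

/-! ### Abel summation -/

/-- With `w 0 = 0` the partial sums from `0` and from `1` agree. [folklore] -/
theorem sum_Icc_zero_eq (hw : w 0 = 0) (m : ℕ) :
    ∑ k ∈ Finset.Icc 0 m, w k = ∑ k ∈ Finset.Icc 1 m, w k := by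
  have h : Finset.Icc 1 m = Finset.Ioc 0 m := by ext n; simp; omega
  rw [Finset.Icc_eq_cons_Ioc (Nat.zero_le m), sum_cons, hw, zero_add, h]

/-- **Abel summation**: for `1 ≤ V < x` (`L = log x`),
`∑_{n ≤ V} w(n) (log(L − log n) − log(L − log V)) = ∫_1^V M(t) dt/(t (L − log t))`
(Mathlib's `sum_mul_eq_sub_sub_integral_mul` with `f(t) = log(L − log t) − log(L − log V)`,
`f(V) = 0`, `f'(t) = −1/(t (L − log t))`). [cite: MontgomeryVaughan2007, §2.1] -/
theorem sum_mul_log_sub_eq_integral (hw : w 0 = 0) {x V : ℝ} (hV : 1 ≤ V) (hVx : V < x) :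
    ∑ n ∈ Icc 1 ⌊V⌋₊, w n * (Real.log (Real.log x - Real.log n) - Real.log (Real.log x - Real.log V)) =
      ∫ t in (1 : ℝ)..V, (∑ n ∈ Icc 1 ⌊t⌋₊, w n) / (t * (Real.log x - Real.log t)) := by
  set L := Real.log x with hL
  set φ : ℝ → ℝ := fun t => Real.log (L - Real.log t) - Real.log (L - Real.log V) with hφ
  set φ' : ℝ → ℝ := fun t => -(1 / (t * (L - Real.log t))) with hφ'
  -- on `[1, V]`: `t > 0` and `log t < L`
  have hmem : ∀ t ∈ Set.Icc 1 V, 0 < t ∧ 0 < L - Real.log t := by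
    intro t ht
    have ht0 : 0 < t := by linarith [ht.1]
    have : Real.log t < L := Real.log_lt_log ht0 (lt_of_le_of_lt ht.2 hVx)
    exact ⟨ht0, by linarith⟩
  have hderiv : ∀ t ∈ Set.Icc 1 V, HasDerivAt φ (φ' t) t := by
    intro t ht
    obtain ⟨ht0, hLt⟩ := hmem t ht
    have h1 : HasDerivAt (fun s => L - Real.log s) (0 - t⁻¹) t :=
      (hasDerivAt_const t L).sub (Real.hasDerivAt_log ht0.ne')
    have h2 : HasDerivAt (fun s => Real.log (L - Real.log s)) ((0 - t⁻¹) / (L - Real.log t)) t :=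
      h1.log hLt.ne'
    have h3 := h2.sub_const (Real.log (L - Real.log V))
    have h4 : (0 - t⁻¹) / (L - Real.log t) = φ' t := by
      simp only [hφ']
      field_simp
      ring
    rw [h4] at h3
    exact h3
  have hφ'cont : ContinuousOn φ' (Set.Icc 1 V) := by
    simp only [hφ']
    refine ContinuousOn.neg (continuousOn_const.div ?_ ?_)
    · refine continuousOn_id.mul (continuousOn_const.sub ?_)
      exact Real.continuousOn_log.mono fun t ht => ne_of_gt (hmem t ht).1
    · intro t ht
      obtain ⟨ht0, hLt⟩ := hmem t ht
      positivity
  have hdiff : ∀ t ∈ Set.Icc 1 V, DifferentiableAt ℝ φ t := fun t ht => (hderiv t ht).differentiableAt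
  have hderiv_eq : ∀ t ∈ Set.Icc 1 V, deriv φ t = φ' t := fun t ht => (hderiv t ht).deriv
  have hint : IntegrableOn (deriv φ) (Set.Icc 1 V) :=
    hφ'cont.integrableOn_Icc.congr_fun (fun t ht => (hderiv_eq t ht).symm) measurableSet_Icc
  have habel := sum_mul_eq_sub_sub_integral_mul (𝕜 := ℝ) w zero_le_one hV hdiff hint
  rw [Nat.floor_one] at habel
  -- `φ V = 0`, `∑_{k ≤ 1} w k = w 1`
  have hφV : φ V = 0 := by simp only [hφ]; ring
  have hs1 : ∑ k ∈ Finset.Icc 0 1, w k = w 1 := by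
    rw [sum_Icc_zero_eq w hw, Finset.Icc_self, sum_singleton]
  rw [hφV, zero_mul, zero_sub, hs1] at habel
  -- split off the term `n = 1` on the left
  have hV1 : 1 ≤ ⌊V⌋₊ := (Nat.one_le_floor_iff V).mpr hV
  have hsplit : ∑ n ∈ Icc 1 ⌊V⌋₊, w n * φ n = w 1 * φ 1 + ∑ n ∈ Finset.Ioc 1 ⌊V⌋₊, φ n * w n := by
    rw [Finset.Icc_eq_cons_Ioc hV1, sum_cons]
    congr 1
    · push_cast; ring
    · exact sum_congr rfl fun n _ => mul_comm _ _
  have hlhs : ∑ n ∈ Icc 1 ⌊V⌋₊,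
      w n * (Real.log (Real.log x - Real.log n) - Real.log (Real.log x - Real.log V)) =
      ∑ n ∈ Icc 1 ⌊V⌋₊, w n * φ n := rfl
  rw [hlhs, hsplit, habel]
  -- the integral
  rw [intervalIntegral.integral_of_le hV]
  have hI : ∫ t in Set.Ioc 1 V, deriv φ t * ∑ k ∈ Finset.Icc 0 ⌊t⌋₊, w k =
      ∫ t in Set.Ioc 1 V, -((∑ n ∈ Icc 1 ⌊t⌋₊, w n) / (t * (Real.log x - Real.log t))) := by
    refine setIntegral_congr_fun measurableSet_Ioc fun t ht => ?_
    rw [hderiv_eq t (Set.Ioc_subset_Icc_self ht), sum_Icc_zero_eq w hw]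
    simp only [hφ']
    ring
  rw [hI, MeasureTheory.integral_neg]
  ring

/-! ### Integration by parts through the log-Riesz mean -/

/-- **Integration by parts** (right derivatives): for `1 ≤ V < x`,
`∫_1^V M(t) dt/(t (L − log t)) = R(V)/(L − log V) − ∫_1^V R(t) dt/(t (L − log t)²)`.
[cite: MontgomeryVaughan2007, §2.1] -/
theorem integral_partialSum_div_eq {x V : ℝ} (hV : 1 ≤ V) (hVx : V < x) :
    ∫ t in (1 : ℝ)..V, (∑ n ∈ Icc 1 ⌊t⌋₊, w n) / (t * (Real.log x - Real.log t)) =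
      (∑ n ∈ Icc 1 ⌊V⌋₊, w n * Real.log (V / n)) / (Real.log x - Real.log V) -
        ∫ t in (1 : ℝ)..V, (∑ n ∈ Icc 1 ⌊t⌋₊, w n * Real.log (t / n)) /
          (t * (Real.log x - Real.log t) ^ 2) := by
  set L := Real.log x with hL
  set R : ℝ → ℝ := fun t => ∑ n ∈ Icc 1 ⌊t⌋₊, w n * Real.log (t / n) with hR
  set M : ℝ → ℝ := fun t => ∑ n ∈ Icc 1 ⌊t⌋₊, w n with hM
  set Φ : ℝ → ℝ := fun t => R t * (L - Real.log t)⁻¹ with hΦ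
  set Φ' : ℝ → ℝ := fun t =>
    M t / (t * (L - Real.log t)) + R t / (t * (L - Real.log t) ^ 2) with hΦ'
  -- on `[1, V]`: `t > 0` and `log t < L`
  have hmem : ∀ t ∈ Set.Icc 1 V, 0 < t ∧ 0 < L - Real.log t := by
    intro t ht
    have ht0 : 0 < t := by linarith [ht.1]
    have : Real.log t < L := Real.log_lt_log ht0 (lt_of_le_of_lt ht.2 hVx)
    exact ⟨ht0, by linarith⟩
  have hlogc : ContinuousOn Real.log (Set.Icc 1 V) :=
    Real.continuousOn_log.mono fun t ht => ne_of_gt (hmem t ht).1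
  have hsubc : ContinuousOn (fun t => L - Real.log t) (Set.Icc 1 V) := continuousOn_const.sub hlogc
  have hsub0 : ∀ t ∈ Set.Icc 1 V, L - Real.log t ≠ 0 := fun t ht => (hmem t ht).2.ne'
  have ht0' : ∀ t ∈ Set.Icc 1 V, (t : ℝ) ≠ 0 := fun t ht => (hmem t ht).1.ne'
  -- continuity of `Φ`, `R`, and of the two weights
  have hRc : ContinuousOn R (Set.Icc 1 V) := continuousOn_logRiesz w V
  have hΦc : ContinuousOn Φ (Set.Icc 1 V) := hRc.mul (hsubc.inv₀ hsub0)
  have hg1c : ContinuousOn (fun t : ℝ => 1 / (t * (L - Real.log t))) (Set.Icc 1 V) :=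
    continuousOn_const.div (continuousOn_id.mul hsubc) fun t ht => mul_ne_zero (ht0' t ht) (hsub0 t ht)
  have hg2c : ContinuousOn (fun t : ℝ => 1 / (t * (L - Real.log t) ^ 2)) (Set.Icc 1 V) :=
    continuousOn_const.div (continuousOn_id.mul (hsubc.pow 2)) fun t ht =>
      mul_ne_zero (ht0' t ht) (pow_ne_zero 2 (hsub0 t ht))
  -- right derivative of `Φ`
  have hΦd : ∀ t ∈ Set.Ioo 1 V, HasDerivWithinAt Φ (Φ' t) (Set.Ioi t) t := by
    intro t ht
    obtain ⟨ht0, hLt⟩ := hmem t ⟨ht.1.le, ht.2.le⟩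
    have hRd := hasDerivWithinAt_logRiesz w ht.1.le
    have h1 : HasDerivAt (fun s => L - Real.log s) (0 - t⁻¹) t :=
      (hasDerivAt_const t L).sub (Real.hasDerivAt_log ht0.ne')
    have h2 := h1.inv hLt.ne'
    have h := hRd.mul h2.hasDerivWithinAt
    have h' : HasDerivWithinAt Φ ((∑ n ∈ Finset.Icc 1 ⌊t⌋₊, w n) / t * (L - Real.log t)⁻¹ +
        (∑ n ∈ Finset.Icc 1 ⌊t⌋₊, w n * Real.log (t / n)) *
          (-(0 - t⁻¹) / (L - Real.log t) ^ 2)) (Set.Ioi t) t := h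
    refine h'.congr_deriv ?_
    rw [hΦ', hM, hR]
    field_simp
    ring
  -- integrability of `Φ'`
  have hI1 : IntegrableOn (fun t : ℝ => 1 / (t * (L - Real.log t)) * M t) (Set.Icc 1 V) := by
    have h := integrableOn_mul_sum_Icc (𝕜 := ℝ) w (m := 1) zero_le_one hg1c.integrableOn_Icc
    exact h
  have hI2 : IntegrableOn (fun t : ℝ => 1 / (t * (L - Real.log t) ^ 2) * R t) (Set.Icc 1 V) :=
    (hg2c.mul hRc).integrableOn_Icc
  have hI1' : IntervalIntegrable (fun t : ℝ => M t / (t * (L - Real.log t))) volume 1 V := by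
    rw [intervalIntegrable_iff_integrableOn_Icc_of_le hV]
    refine hI1.congr_fun (fun t _ => ?_) measurableSet_Icc
    ring
  have hI2' : IntervalIntegrable (fun t : ℝ => R t / (t * (L - Real.log t) ^ 2)) volume 1 V := by
    rw [intervalIntegrable_iff_integrableOn_Icc_of_le hV]
    refine hI2.congr_fun (fun t _ => ?_) measurableSet_Icc
    ring
  have hΦ'i : IntervalIntegrable Φ' volume 1 V := hI1'.add hI2'
  have hFTC := intervalIntegral.integral_eq_sub_of_hasDeriv_right_of_le hV hΦc hΦd hΦ'i
  have hΦ1 : Φ 1 = 0 := by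
    simp only [hΦ, hR, Nat.floor_one, Finset.Icc_self, sum_singleton, Nat.cast_one, div_one,
      Real.log_one, mul_zero, zero_mul]
  have hsplit : ∫ t in (1 : ℝ)..V, Φ' t =
      (∫ t in (1 : ℝ)..V, M t / (t * (L - Real.log t))) +
        ∫ t in (1 : ℝ)..V, R t / (t * (L - Real.log t) ^ 2) :=
    intervalIntegral.integral_add hI1' hI2'
  rw [hsplit, hΦ1, sub_zero] at hFTC
  have hΦV : Φ V = R V / (L - Real.log V) := by simp only [hΦ, div_eq_mul_inv]
  rw [hΦV] at hFTC
  linarith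

/-! ### Extracting the main term -/

/-- **Main term**: if `|R(t) − C| ≤ E(t)` for `t ∈ [1, V]`, `E` is integrable with
`∫_1^V E(t) dt/t ≤ I`, and `1 ≤ V < x`, then
`|∫_1^V R(t) dt/(t (L − log t)²) − C (1/(L − log V) − 1/L)| ≤ I/(L − log V)²`.
[folklore] -/
theorem abs_integral_logRiesz_div_sub_le {x V C I : ℝ} {E : ℝ → ℝ} (hV : 1 ≤ V) (hVx : V < x)
    (hE : ∀ t ∈ Icc 1 V, |(∑ n ∈ Icc 1 ⌊t⌋₊, w n * Real.log (t / n)) - C| ≤ E t)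
    (hEi : IntervalIntegrable E volume 1 V) (hI : ∫ t in (1 : ℝ)..V, E t / t ≤ I) :
    |(∫ t in (1 : ℝ)..V, (∑ n ∈ Icc 1 ⌊t⌋₊, w n * Real.log (t / n)) /
          (t * (Real.log x - Real.log t) ^ 2)) -
        C * (1 / (Real.log x - Real.log V) - 1 / Real.log x)| ≤
      I / (Real.log x - Real.log V) ^ 2 := by
  set L := Real.log x with hL
  set R : ℝ → ℝ := fun t => ∑ n ∈ Icc 1 ⌊t⌋₊, w n * Real.log (t / n) with hR
  set ℓ := L - Real.log V with hℓ
  -- on `[1, V]`: `t > 0` and `log t ≤ log V < L`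
  have hmem : ∀ t ∈ Set.Icc 1 V, 0 < t ∧ ℓ ≤ L - Real.log t ∧ 0 < L - Real.log t := by
    intro t ht
    have ht0 : 0 < t := by linarith [ht.1]
    have h1 : Real.log t ≤ Real.log V := Real.log_le_log ht0 ht.2
    have h2 : Real.log V < L := Real.log_lt_log (by linarith) hVx
    exact ⟨ht0, by rw [hℓ]; linarith, by linarith⟩
  have hℓ0 : 0 < ℓ := by
    have := (hmem V ⟨hV, le_rfl⟩).2.1
    have := (hmem V ⟨hV, le_rfl⟩).2.2
    rw [hℓ]; linarith [Real.log_lt_log (by linarith : (0:ℝ) < V) hVx]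
  have huIcc : Set.uIcc 1 V = Set.Icc 1 V := Set.uIcc_of_le hV
  have hlogc : ContinuousOn Real.log (Set.Icc 1 V) :=
    Real.continuousOn_log.mono fun t ht => ne_of_gt (hmem t ht).1
  have hsubc : ContinuousOn (fun t => L - Real.log t) (Set.Icc 1 V) := continuousOn_const.sub hlogc
  have hsub0 : ∀ t ∈ Set.Icc 1 V, L - Real.log t ≠ 0 := fun t ht => (hmem t ht).2.2.ne'
  have ht0' : ∀ t ∈ Set.Icc 1 V, (t : ℝ) ≠ 0 := fun t ht => (hmem t ht).1.ne'
  have hg2c : ContinuousOn (fun t : ℝ => 1 / (t * (L - Real.log t) ^ 2)) (Set.Icc 1 V) :=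
    continuousOn_const.div (continuousOn_id.mul (hsubc.pow 2)) fun t ht =>
      mul_ne_zero (ht0' t ht) (pow_ne_zero 2 (hsub0 t ht))
  have hRc : ContinuousOn R (Set.Icc 1 V) := continuousOn_logRiesz w V
  -- (i) `∫_1^V C dt/(t (L − log t)²) = C (1/ℓ − 1/L)`
  have hFTC : ∫ t in (1 : ℝ)..V, t⁻¹ / (L - Real.log t) ^ 2 = 1 / ℓ - 1 / L := by
    have hderiv : ∀ t ∈ Set.uIcc 1 V,
        HasDerivAt (fun s => (L - Real.log s)⁻¹) (t⁻¹ / (L - Real.log t) ^ 2) t := by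
      intro t ht
      rw [huIcc] at ht
      obtain ⟨ht0, -, hLt⟩ := hmem t ht
      have h1 : HasDerivAt (fun s => L - Real.log s) (0 - t⁻¹) t :=
        (hasDerivAt_const t L).sub (Real.hasDerivAt_log ht0.ne')
      have h2 : HasDerivAt (fun s => (L - Real.log s)⁻¹) (-(0 - t⁻¹) / (L - Real.log t) ^ 2) t :=
        h1.inv hLt.ne'
      exact h2.congr_deriv (by ring)
    have hcont : ContinuousOn (fun t : ℝ => t⁻¹ / (L - Real.log t) ^ 2) (Set.Icc 1 V) := by
      refine hg2c.congr fun t _ => ?_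
      simp only
      rw [inv_eq_one_div, div_div]
    have h := intervalIntegral.integral_eq_sub_of_hasDerivAt hderiv (hcont.intervalIntegrable_of_Icc hV)
    rw [h, Real.log_one, sub_zero, hℓ]
    simp only [one_div]
  -- interval integrability of the pieces
  have hRg : IntervalIntegrable (fun t : ℝ => R t / (t * (L - Real.log t) ^ 2)) volume 1 V := by
    refine ((hRc.mul hg2c).intervalIntegrable_of_Icc hV).congr fun t _ => ?_
    simp only [Pi.mul_apply]
    ring
  have hCg : IntervalIntegrable (fun t : ℝ => C * (t⁻¹ / (L - Real.log t) ^ 2)) volume 1 V := by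
    refine (((continuousOn_const (c := C)).mul hg2c).intervalIntegrable_of_Icc hV).congr
      fun t _ => ?_
    simp only [Pi.mul_apply]
    rw [inv_eq_one_div, div_div]
  have hdiff : (∫ t in (1 : ℝ)..V, R t / (t * (L - Real.log t) ^ 2)) - C * (1 / ℓ - 1 / L) =
      ∫ t in (1 : ℝ)..V, (R t - C) / (t * (L - Real.log t) ^ 2) := by
    rw [← hFTC, ← intervalIntegral.integral_const_mul, ← intervalIntegral.integral_sub hRg hCg]
    refine intervalIntegral.integral_congr fun t _ => ?_
    rw [inv_eq_one_div, div_div]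
    ring
  rw [hdiff]
  -- pointwise domination `|R − C|/(t (L − log t)²) ≤ E(t)/t · 1/ℓ²`
  have hdom : ∀ t ∈ Set.Icc 1 V,
      |(R t - C) / (t * (L - Real.log t) ^ 2)| ≤ E t / t * (1 / ℓ ^ 2) := by
    intro t ht
    obtain ⟨ht0, hℓt, hLt⟩ := hmem t ht
    have hEt : |R t - C| ≤ E t := hE t ht
    have hE0 : 0 ≤ E t := (abs_nonneg _).trans hEt
    rw [abs_div, abs_of_pos (by positivity : 0 < t * (L - Real.log t) ^ 2)]
    rw [div_mul_div_comm, mul_one, div_le_div_iff₀ (by positivity) (by positivity)]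
    have hsq : ℓ ^ 2 ≤ (L - Real.log t) ^ 2 := pow_le_pow_left₀ hℓ0.le hℓt 2
    calc |R t - C| * (t * ℓ ^ 2) ≤ E t * (t * ℓ ^ 2) :=
          mul_le_mul_of_nonneg_right hEt (by positivity)
      _ ≤ E t * (t * (L - Real.log t) ^ 2) := by gcongr
  have habsint : IntervalIntegrable (fun t : ℝ => |(R t - C) / (t * (L - Real.log t) ^ 2)|)
      volume 1 V := by
    refine IntervalIntegrable.abs ?_
    refine (((hRc.sub (continuousOn_const (c := C))).mul hg2c).intervalIntegrable_of_Icc hV).congr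
      fun t _ => ?_
    simp only [Pi.mul_apply, Pi.sub_apply]
    ring
  have hEint : IntervalIntegrable (fun t : ℝ => E t / t * (1 / ℓ ^ 2)) volume 1 V := by
    have h1 : IntervalIntegrable (fun t : ℝ => E t / t) volume 1 V := by
      refine (hEi.mul_continuousOn (g := fun t : ℝ => t⁻¹) ?_).congr fun t _ => ?_
      · rw [huIcc]
        exact (continuousOn_inv₀.mono fun t ht => ht0' t ht)
      · simp only [div_eq_mul_inv]
    exact h1.mul_const _
  calc |∫ t in (1 : ℝ)..V, (R t - C) / (t * (L - Real.log t) ^ 2)|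
      ≤ ∫ t in (1 : ℝ)..V, |(R t - C) / (t * (L - Real.log t) ^ 2)| :=
        intervalIntegral.abs_integral_le_integral_abs hV
    _ ≤ ∫ t in (1 : ℝ)..V, E t / t * (1 / ℓ ^ 2) :=
        intervalIntegral.integral_mono_on hV habsint hEint hdom
    _ = (∫ t in (1 : ℝ)..V, E t / t) * (1 / ℓ ^ 2) := intervalIntegral.integral_mul_const _ _
    _ ≤ I * (1 / ℓ ^ 2) := mul_le_mul_of_nonneg_right hI (by positivity)
    _ = I / ℓ ^ 2 := by ring

/-- **The three steps combined**: under the hypotheses of `abs_integral_logRiesz_div_sub_le` and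
`w 0 = 0`,
`|∑_{n ≤ V} w(n)(log(L − log n) − log(L − log V)) − C/L − (R(V) − C)/(L − log V)| ≤ I/(L − log V)²`.
[folklore] -/
theorem abs_sum_mul_log_sub_sub_main_le (hw : w 0 = 0) {x V C I : ℝ} {E : ℝ → ℝ} (hV : 1 ≤ V)
    (hVx : V < x)
    (hE : ∀ t ∈ Icc 1 V, |(∑ n ∈ Icc 1 ⌊t⌋₊, w n * Real.log (t / n)) - C| ≤ E t)
    (hEi : IntervalIntegrable E volume 1 V) (hI : ∫ t in (1 : ℝ)..V, E t / t ≤ I) :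
    |(∑ n ∈ Icc 1 ⌊V⌋₊,
          w n * (Real.log (Real.log x - Real.log n) - Real.log (Real.log x - Real.log V))) -
        C / Real.log x -
        ((∑ n ∈ Icc 1 ⌊V⌋₊, w n * Real.log (V / n)) - C) / (Real.log x - Real.log V)| ≤
      I / (Real.log x - Real.log V) ^ 2 := by
  rw [sum_mul_log_sub_eq_integral w hw hV hVx, integral_partialSum_div_eq w hV hVx]
  have h := abs_integral_logRiesz_div_sub_le w hV hVx hE hEi hI
  rw [abs_sub_comm] at h
  convert h using 2
  ring

end LogRieszAbel

end Literature.NumberTheory.LFunctions
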